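import Summits.QuantumFields.Balaban3D.Proofs.Run3Collar
import Summits.QuantumFields.YangMills.Theorems.UnitScaleTiltProp7TorusExpWeightSum
import Literature.MathematicalPhysics.QuantumFieldTheory.Balaban1983to89.T3SectALandauChart
import Literature.MathematicalPhysics.QuantumFieldTheory.Balaban1983to89.B5Eq118OneStroke
import HarnessLib

/-!
# Route `UnitScaleTilt`, crux K1 «MinimiserStabilityRegPr» (stmt-QuantumFields-19200), EX row `hGF` (curved member), the LOD line (★p1 g24 `LOCATE-L6-ASSEMBLY`,
# ★★OWNER RULINGS №33 ∕ №34) — **PEN B3: BLOCK-DISTANCE AGMON WEIGHTS ON THE T³ MEMBER** (routeR-w2 g12's (L5′-member) spec of 2026-08-29 23:47Z, typed by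
# width seat `ym3-torus-px12` gen 13).  Pure lattice geometry of the member torus `Site (F.P K) 0` with its `(K − n)`-blocks `B(y) = iterBlock (K − n) y` (side
# `ℓ = L^{K−n}`, `η = eta F n K = ℓ⁻¹`): for every coarse site `y` and rate `μ ≥ 0` an Agmon weight `φ_y(x) = μ·η·dist₁(x, B(y))` with the rows the LOD engines
# consume, the K-∕volume-free exponential volume of the coarse torus, and the pseudo-metric rows of the coarse `ℓ¹` distance.

Cell `ym3-torus` (HUMAN RULING D-0037: YM₃ on T³ is ladder rung R3 — NOT d = 4, NOT infinite volume, NOT a mass gap, NOT Clay).  THEOREMS ONLY (0 `def`, 0 `sorry`);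
the weight is delivered in `∃`-form (definition-free), its formula stated in the docstring.  `--supports stmt-QuantumFields-19200 --as helper`, count-neutral.
HONEST LABEL (№33 (6)): geometry letters of the curved γ-row supplier line; nothing of (3.49), Thm 3.1∕3.3, `hGF`, `h349`, EX or the crux proved.

CONSUMERS (output shapes pinned token for token): `hφ`∕`hφc` of ✓`Prop7MassivePropagatorAgmon.agmon_rows_exp` (px5 g11, p749343: per-bond slope `θ := μη`, in-block
oscillation `θ′ := 3μ`), `hφy`∕`hφz` of ✓`Prop7ComplementaryProjectorColumns.norm_inner_massive_column_le` (routeR-w2 g12, p750882: `φ = 0` on `B(y)`, `R ≤ φ` on `B(z)` with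
`R := μ·(tdist z y − 3)`), and `hds`∕`hdt`∕`hvol'` of ✓`Prop7SpanProjectorGramForm.norm_inner_starProjection_le_exp` (p749838: `dc z y := tdist z y` on `Site (F.P K) (K − n)`,
`cV' := (2(1 + 1∕ν))³`).

THE MATHEMATICS ([Balaban1985BackgroundPropagators] Thm 3.1 (3.46) p. 398 and (3.49) p. 399: decay `e^{−δ₀ d(y,y′)}` in the COARSE distance of the blocks containing the
arguments, obtained here — as in the LOD line — from a Combes–Thomas∕Agmon conjugation by a block-adapted weight; [Balaban1985Averaging] (2) p. 17 the blocks).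
`dist₁(x, B(y)) = min_{x′ ∈ B(y)} |x − x′|₁` is `1`-Lipschitz for the fine `ℓ¹` torus distance (triangle inequality), vanishes on `B(y)`, oscillates by `≤ d(ℓ − 1)` inside a
block (two sites of one block are `≤ d(ℓ−1)` apart, ✓`CollarCount.tdist_le_of_labels_div_eq`), and bounds the coarse distance from below through the CONTRACTION of the block
map, `tdist(B x, B x′) ≤ |x − x′|₁∕ℓ + d` (✓`CollarCount.coarse_dist_le` per coordinate at modulus ratio `ℓ = L^{K−n}`); multiplying by `μη = μ∕ℓ` gives slope `μη` per bond,
oscillation `≤ 3μ`, and `φ_y ≥ μ(tdist(z, y) − 3)` on `B(z)`.  The coarse volume `Σ_z e^{−ν·tdist(z,w)} ≤ (2(1 + 1∕ν))^d` is ✓`Prop7TorusExpWeightSum.sum_exp_neg_mul_tdist_le`.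

WHAT IS PROVED (ns `…Theorems.Prop7BlockDistanceWeights`; member `F`, heights `n ≤ K`): §1 `sitesPerDir_zero_eq_mul_pow`, ★`tdist_iterBlockOf_le` (contraction at ratio `L^k`),
`tdist_le_of_iterBlockOf_eq` (block diameter), `tdist_src_tgt_le_one`, `eta_mul_pow_eq_one`; §2 ★★★`exists_blockDistanceWeight` (the weight pair `(φ_y, φc_y)` with the six
rows (W1)); §3 ★`sum_exp_neg_mul_tdist_coarse_le` ((W2)), `tdist_coarse_comm`, `tdist_coarse_triangle` ((W3), real-cast).
HONEST SCOPE.  Lattice geometry only; no operator, no estimate of print; the Agmon∕Combes–Thomas use is the consumers'.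

References: T. Bałaban, CMP **99** (1985) 389–434 [Balaban1985BackgroundPropagators] (Thm 3.1 (3.46) p.398, (3.49) p.399); CMP **98** (1985) 17–51 [Balaban1985Averaging]
((2) p.17); CMP **102** (1985) 255–275 [Balaban1985UV3] ((39) p.266, the block geometry of the d = 3 lattices).
-/

set_option autoImplicit false

noncomputable section

open scoped BigOperators

namespace Summit.QuantumFields.YangMills.Theorems.Prop7BlockDistanceWeights

open Literature.MathematicalPhysics.QuantumFieldTheory.Balaban1983to89
open Literature.MathematicalPhysics.QuantumFieldTheory.Balaban1983to89.T3ContinuumYM3Torus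
open T3SectALandauChart (eta eta_pos)
open B5Eq118OneStroke (iterBlockOf iterBlock mem_iterBlock val_iterBlockOf card_iterBlock)
open B3Taylor310LocalRemainder (tdist_comm tdist_triangle)
open Summit.QuantumFields.Balaban3D.Proofs.CollarCount (coarse_dist_le sum_div_le tdist_le_of_labels_div_eq)
open Summit.QuantumFields.Balaban3D.Proofs.Run3Collar (tdist_shift_le)
open Summit.QuantumFields.YangMills.Theorems.Prop7TorusExpWeightSum (sum_exp_neg_mul_tdist_le)

/-! ## §1 Torus bookkeeping at modulus ratio `L^k`: contraction of the `k`-fold block map, block diameter, bond length, `η·L^{K−n} = 1` -/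

section Torus

variable {P : Params}

/-- The finest torus has `L^k` times the sites per direction of `T^{(k)}` (standing range `k ≤ m + K`). [cite: Balaban1985Averaging, (2) p.17] -/
theorem sitesPerDir_zero_eq_mul_pow : ∀ (k : ℕ), k ≤ P.m + P.K → P.sitesPerDir 0 = P.sitesPerDir k * P.L ^ k
  | 0, _ => by rw [pow_zero, mul_one]
  | k + 1, hk => by
    rw [sitesPerDir_zero_eq_mul_pow k (by omega), P.sitesPerDir_eq_mul_succ hk, pow_succ', mul_assoc]

/-- ★ **CONTRACTION OF THE `k`-FOLD BLOCK MAP**: `tdist (B^k x) (B^k x′) ≤ |x − x′|₁ ∕ L^k + d` (natural division) — ✓`CollarCount.coarse_dist_le` per coordinate at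
modulus ratio `L^k` (labels of `B^k x` = labels of `x` div `L^k`, ✓`val_iterBlockOf`). [cite: Balaban1985Averaging, (2) p.17; Balaban1985UV3, (39) p.266] -/
theorem tdist_iterBlockOf_le {k : ℕ} (hk : k ≤ P.m + P.K) (x x' : Site P 0) :
    Site.tdist (iterBlockOf k x) (iterBlockOf k x') ≤ Site.tdist x x' / P.L ^ k + P.d := by
  have hL : 0 < P.L ^ k := pow_pos P.L_pos k
  have hn : P.sitesPerDir 0 = P.sitesPerDir k * P.L ^ k := sitesPerDir_zero_eq_mul_pow k hk
  have hcoord : ∀ μ : Fin P.d,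
      min ((iterBlockOf k x) μ - (iterBlockOf k x') μ).val ((iterBlockOf k x') μ - (iterBlockOf k x) μ).val ≤
        min (x μ - x' μ).val (x' μ - x μ).val / P.L ^ k + 1 :=
    fun μ => coarse_dist_le hn hL (x μ) (x' μ) _ _ (val_iterBlockOf k hk x μ) (val_iterBlockOf k hk x' μ)
  unfold Site.tdist
  calc ∑ μ, min ((iterBlockOf k x) μ - (iterBlockOf k x') μ).val ((iterBlockOf k x') μ - (iterBlockOf k x) μ).val
      ≤ ∑ μ, (min (x μ - x' μ).val (x' μ - x μ).val / P.L ^ k + 1) := Finset.sum_le_sum fun μ _ => hcoord μ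
    _ = ∑ μ, min (x μ - x' μ).val (x' μ - x μ).val / P.L ^ k + P.d := by rw [Finset.sum_add_distrib]; simp
    _ ≤ (∑ μ, min (x μ - x' μ).val (x' μ - x μ).val) / P.L ^ k + P.d := Nat.add_le_add_right (sum_div_le _ _ _) _

/-- **BLOCK DIAMETER**: two fine sites of one `k`-block are `≤ d(L^k − 1)` apart. [cite: Balaban1985Averaging, (2) p.17] -/
theorem tdist_le_of_iterBlockOf_eq {k : ℕ} (hk : k ≤ P.m + P.K) {x x' : Site P 0} (h : iterBlockOf k x = iterBlockOf k x') :
    Site.tdist x x' ≤ P.d * (P.L ^ k - 1) :=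
  tdist_le_of_labels_div_eq x x' (pow_pos P.L_pos k) fun μ => by
    rw [← val_iterBlockOf k hk x μ, ← val_iterBlockOf k hk x' μ, h]

/-- A bond has `ℓ¹` length `≤ 1`: `tdist b₋ b₊ ≤ 1`. [folklore] -/
theorem tdist_src_tgt_le_one {j : ℕ} (b : PBond P j) : Site.tdist b.src b.tgt ≤ 1 :=
  tdist_shift_le b.src b.dir

end Torus

section Member

variable (F : T3Family) {n K : ℕ}

/-- `η·L^{K−n} = 1` (`η = (L⁻¹)^{K−n}`). [cite: Balaban1985Variational, (2) p.278] -/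
theorem eta_mul_pow_eq_one : eta F n K * (F.L : ℝ) ^ (K - n) = 1 := by
  have hL0 : 0 < F.L := (F.P K).L_pos
  have hL : (F.L : ℝ) ≠ 0 := by exact_mod_cast hL0.ne'
  rw [T3SectALandauChart.eta, inv_pow, inv_mul_cancel₀ (pow_ne_zero _ hL)]

/-! ## §2 ★★★ The block-distance Agmon weight -/

/-- ★★★ **THE BLOCK-DISTANCE AGMON WEIGHT OF A COARSE SITE** (B3).  For `n ≤ K`, a coarse site `y : Site (F.P K) (K − n)` and `μ ≥ 0` there are `φ : Site (F.P K) 0 → ℝ` and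
`φc : Site (F.P K) (K − n) → ℝ` — namely `φ x = μ·η·min_{x′ ∈ B(y)} tdist x x′` and `φc z = φ(a site of B(z))`, `η = eta F n K`, `B = iterBlock (K − n)` — with:
(o) `0 ≤ φ`; (i) PER-BOND SLOPE `|φ b₊ − φ b₋| ≤ μη`; (i′) `|φ x − φ x′| ≤ μη·tdist x x′`; (ii) IN-BLOCK OSCILLATION `|φ x − φc (B x)| ≤ 3μ`; (iii) `φ = 0` on `B(y)`;
(iv) ★★ LOWER BOUND `μ·(tdist z y − 3) ≤ φ x` for `x ∈ B(z)` (coarse `ℓ¹` distance).  These are the hypotheses `hφ`, `hφc` of ✓`agmon_rows_exp` (`θ = μη`, `θ′ = 3μ`) and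
`hφy`, `hφz` of ✓`norm_inner_massive_column_le` (`R = μ(tdist z y − 3)`). [cite: Balaban1985BackgroundPropagators, Thm 3.1 (3.46) p.398, (3.49) p.399; Balaban1985Averaging, (2) p.17] -/
theorem exists_blockDistanceWeight (hnK : n ≤ K) (y : Site (F.P K) (K - n)) {μ : ℝ} (hμ : 0 ≤ μ) :
    ∃ (φ : Site (F.P K) 0 → ℝ) (φc : Site (F.P K) (K - n) → ℝ),
      (∀ x, 0 ≤ φ x) ∧
      (∀ bd : PBond (F.P K) 0, |φ bd.tgt - φ bd.src| ≤ μ * eta F n K) ∧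
      (∀ x x', |φ x - φ x'| ≤ μ * eta F n K * (Site.tdist x x' : ℝ)) ∧
      (∀ x, |φ x - φc (iterBlockOf (K - n) x)| ≤ 3 * μ) ∧
      (∀ x, iterBlockOf (K - n) x = y → φ x = 0) ∧
      (∀ (z : Site (F.P K) (K - n)) (x : Site (F.P K) 0), iterBlockOf (K - n) x = z → μ * ((Site.tdist z y : ℝ) - 3) ≤ φ x) := by
  classical
  have hk : K - n ≤ (F.P K).m + (F.P K).K := by show K - n ≤ F.m + K; omega
  have hη : 0 < eta F n K := eta_pos F n K
  have hημ : 0 ≤ μ * eta F n K := mul_nonneg hμ hη.le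
  -- every block is non-empty
  have hne : ∀ z : Site (F.P K) (K - n), (iterBlock (K - n) z).Nonempty := fun z => by
    rw [← Finset.card_pos, card_iterBlock (K - n) hk]; exact pow_pos (pow_pos (F.P K).L_pos _) _
  -- the distance to the block `B(y)`
  set D : Site (F.P K) 0 → ℝ := fun x => (iterBlock (K - n) y).inf' (hne y) (fun x' => (Site.tdist x x' : ℝ)) with hD
  have hD0 : ∀ x, 0 ≤ D x := fun x => Finset.le_inf' _ _ fun x' _ => Nat.cast_nonneg _
  have hDle : ∀ x, ∀ x' ∈ iterBlock (K - n) y, D x ≤ (Site.tdist x x' : ℝ) := fun x x' hx' => Finset.inf'_le _ hx'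
  have hDatt : ∀ x, ∃ x' ∈ iterBlock (K - n) y, D x = (Site.tdist x x' : ℝ) := fun x => Finset.exists_mem_eq_inf' (hne y) _
  -- `D` is `1`-Lipschitz for the fine distance
  have hDlip : ∀ x x', |D x - D x'| ≤ (Site.tdist x x' : ℝ) := by
    intro x x'
    rw [abs_sub_le_iff]
    constructor
    · obtain ⟨w, hw, hwe⟩ := hDatt x'
      have h1 := hDle x w hw
      have h2 : (Site.tdist x w : ℝ) ≤ Site.tdist x x' + Site.tdist x' w := by exact_mod_cast tdist_triangle x x' w
      linarith
    · obtain ⟨w, hw, hwe⟩ := hDatt x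
      have h1 := hDle x' w hw
      have h2 : (Site.tdist x' w : ℝ) ≤ Site.tdist x' x + Site.tdist x w := by exact_mod_cast tdist_triangle x' x w
      have h3 : Site.tdist x' x = Site.tdist x x' := tdist_comm x' x
      rw [h3] at h2
      linarith
  -- a representative site of every block
  have hrep : ∀ z : Site (F.P K) (K - n), ∃ r : Site (F.P K) 0, iterBlockOf (K - n) r = z := fun z => by
    obtain ⟨r, hr⟩ := hne z; exact ⟨r, (mem_iterBlock _ _ _).mp hr⟩
  choose rep hrep using hrep
  refine ⟨fun x => μ * eta F n K * D x, fun z => μ * eta F n K * D (rep z), fun x => mul_nonneg hημ (hD0 x), ?_, ?_, ?_, ?_, ?_⟩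
  · -- (i) per-bond slope
    intro bd
    rw [← mul_sub, abs_mul, abs_of_nonneg hημ]
    calc μ * eta F n K * |D bd.tgt - D bd.src| ≤ μ * eta F n K * (Site.tdist bd.tgt bd.src : ℝ) := mul_le_mul_of_nonneg_left (hDlip _ _) hημ
      _ ≤ μ * eta F n K * 1 := by
          refine mul_le_mul_of_nonneg_left ?_ hημ
          rw [tdist_comm]
          exact_mod_cast tdist_src_tgt_le_one bd
      _ = μ * eta F n K := mul_one _
  · -- (i′) Lipschitz
    intro x x'
    rw [← mul_sub, abs_mul, abs_of_nonneg hημ]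
    exact mul_le_mul_of_nonneg_left (hDlip x x') hημ
  · -- (ii) in-block oscillation: the representative lies in the same block, `≤ d(ℓ − 1)` away
    intro x
    rw [← mul_sub, abs_mul, abs_of_nonneg hημ]
    have hsame : iterBlockOf (K - n) x = iterBlockOf (K - n) (rep (iterBlockOf (K - n) x)) := (hrep (iterBlockOf (K - n) x)).symm
    have hdiam : (Site.tdist x (rep (iterBlockOf (K - n) x)) : ℝ) ≤ (F.P K).d * ((F.P K).L ^ (K - n) - 1 : ℕ) := by
      exact_mod_cast tdist_le_of_iterBlockOf_eq hk hsame
    have hd3 : ((F.P K).d : ℝ) = 3 := by norm_num [T3Family.P_d]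
    have hpow : (((F.P K).L ^ (K - n) - 1 : ℕ) : ℝ) ≤ (F.L : ℝ) ^ (K - n) := by
      have : (((F.P K).L ^ (K - n) - 1 : ℕ) : ℝ) ≤ (((F.P K).L ^ (K - n) : ℕ) : ℝ) := by exact_mod_cast Nat.sub_le _ _
      refine this.trans ?_
      push_cast
      exact le_of_eq rfl
    have hηℓ : eta F n K * (F.L : ℝ) ^ (K - n) = 1 := eta_mul_pow_eq_one F
    calc μ * eta F n K * |D x - D (rep (iterBlockOf (K - n) x))| ≤ μ * eta F n K * (Site.tdist x (rep (iterBlockOf (K - n) x)) : ℝ) :=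
          mul_le_mul_of_nonneg_left (hDlip _ _) hημ
      _ ≤ μ * eta F n K * (3 * (F.L : ℝ) ^ (K - n)) := by
          refine mul_le_mul_of_nonneg_left (hdiam.trans ?_) hημ
          rw [hd3]
          exact mul_le_mul_of_nonneg_left hpow (by norm_num)
      _ = 3 * μ * (eta F n K * (F.L : ℝ) ^ (K - n)) := by ring
      _ = 3 * μ := by rw [hηℓ, mul_one]
  · -- (iii) vanishing on `B(y)`
    intro x hx
    show μ * eta F n K * D x = 0
    have hxm : x ∈ iterBlock (K - n) y := (mem_iterBlock _ _ _).mpr hx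
    have h0 : D x ≤ 0 := by
      have := hDle x x hxm
      rw [B3Taylor310LocalRemainder.tdist_self] at this
      exact_mod_cast this
    rw [le_antisymm h0 (hD0 x), mul_zero]
  · -- (iv) the lower bound through the contraction of the block map
    intro z x hxz
    show _ ≤ μ * eta F n K * D x
    obtain ⟨x', hx', hDx⟩ := hDatt x
    have hx'y : iterBlockOf (K - n) x' = y := (mem_iterBlock _ _ _).mp hx'
    have hcon := tdist_iterBlockOf_le hk x x'
    rw [hxz, hx'y] at hcon
    have hL : (0 : ℝ) < (F.L : ℝ) ^ (K - n) := pow_pos (by exact_mod_cast (F.P K).L_pos) (K - n)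
    have hreal : (Site.tdist z y : ℝ) ≤ (Site.tdist x x' : ℝ) / (F.L : ℝ) ^ (K - n) + 3 := by
      have h1 : (Site.tdist z y : ℝ) ≤ ((Site.tdist x x' / (F.P K).L ^ (K - n) : ℕ) : ℝ) + (F.P K).d := by exact_mod_cast hcon
      have h2 : ((Site.tdist x x' / (F.P K).L ^ (K - n) : ℕ) : ℝ) ≤ (Site.tdist x x' : ℝ) / (F.L : ℝ) ^ (K - n) := by
        have := Nat.cast_div_le (m := Site.tdist x x') (n := (F.P K).L ^ (K - n)) (α := ℝ)
        refine this.trans (le_of_eq ?_)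
        push_cast
        rfl
      have hd3 : ((F.P K).d : ℝ) = 3 := by norm_num [T3Family.P_d]
      linarith
    have hηeq : eta F n K = ((F.L : ℝ) ^ (K - n))⁻¹ := by rw [T3SectALandauChart.eta, inv_pow]
    rw [hDx, hηeq]
    have : μ * ((Site.tdist z y : ℝ) - 3) ≤ μ * ((Site.tdist x x' : ℝ) / (F.L : ℝ) ^ (K - n)) := mul_le_mul_of_nonneg_left (by linarith) hμ
    refine this.trans (le_of_eq ?_)
    rw [div_eq_mul_inv]
    ring

/-! ## §3 The coarse torus: exponential volume and the pseudo-metric rows -/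

/-- ★ **(W2) THE COARSE VOLUME IS K-∕VOLUME-FREE**: `Σ_z e^{−ν·tdist(z, w)} ≤ (2(1 + 1∕ν))³` on `Site (F.P K) (K − n)` for every `ν > 0` and base point `w`
(✓`Prop7TorusExpWeightSum.sum_exp_neg_mul_tdist_le` at `d = 3`) — the `hvol'` of ✓`norm_inner_starProjection_le_exp` with `cV' := (2(1 + 1∕ν))³`.
[cite: Balaban1985BackgroundPropagators, (3.49) p.399] -/
theorem sum_exp_neg_mul_tdist_coarse_le {ν : ℝ} (hν : 0 < ν) (w : Site (F.P K) (K - n)) :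
    ∑ z : Site (F.P K) (K - n), Real.exp (-(ν * (Site.tdist z w : ℝ))) ≤ (2 * (1 + 1 / ν)) ^ 3 :=
  sum_exp_neg_mul_tdist_le w hν

/-- (W3) `dc := tdist` is symmetric (real-cast). [folklore] -/
theorem tdist_coarse_comm (z y : Site (F.P K) (K - n)) : (Site.tdist z y : ℝ) = (Site.tdist y z : ℝ) := by
  exact_mod_cast tdist_comm z y

/-- (W3) `dc := tdist` satisfies the triangle inequality (real-cast). [folklore] -/
theorem tdist_coarse_triangle (z y w : Site (F.P K) (K - n)) : (Site.tdist z w : ℝ) ≤ (Site.tdist z y : ℝ) + (Site.tdist y w : ℝ) := by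
  exact_mod_cast tdist_triangle z y w

end Member

end Summit.QuantumFields.YangMills.Theorems.Prop7BlockDistanceWeights

end
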